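import Summits.QuantumFields.YangMills.Theorems.BalabanUVNodesN15SiteColouredLayerF
import Summits.QuantumFields.YangMills.Theorems.BalabanUVNodesN15FullPropagatorV1XColouredSiteN15At
import Summits.QuantumFields.YangMills.Theorems.BalabanUVNodesN15ContourSums
import Summits.QuantumFields.YangMills.Theorems.BalabanUVNodesN15BackgroundAveragingWords
import Summits.QuantumFields.YangMills.Theorems.BalabanUVNodesN15ExpLetters
import HarnessLib

/-!
# Route «BalabanUVNodes», cluster K4 «SpineRates» — node N15 = NE2: THE SITE LAYER WITH THE BACKGROUND LIVE IN THE TwoGrid ENTRY CURRENCY, XXVII — THE COLOURED LINEARISED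
# AVERAGING SPECIES OF THE SITE LAYER: `F₂(A′) = Q∘M_{k(A′)}`, `F₂*(A′) = M_{k(A′)}∘Q*` with the MATRIX contour kernel `k(A′)(x) = ad(η·Σ_{b∈Γ_{B(x),x}} A′(b))` in coordinates
# (colours MIXED) on the coloured site carriers `Tor(fine) × ι`, and its six letters AT SIZE from FILE 40's `Reg335` — dag-n15-c's vector-piece species `linKerC ∕ linF_letters` on sites

Cell `pub-ymgap`, WIDTH SEAT `pub-ymgap-dag-n15-w1` (generation 3; director-ym №197 ∕ HUMAN RULING D-0149; chair R455 (A) ∕ R461; plan g83 `W-SEAT-START-LIST.md` v11 §n15; (αγ) step 3).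
`bears_on: R4∕N15 · K3⁷ SpineGivenEndpointR13SepCoPH (stmt-QuantumFields-20544)`.  Filed `--supports stmt-QuantumFields-20544 --as helper` — COUNT-NEUTRAL.  Five plumbing `def`s (the matrix
contour kernel, the four species), the rest theorems; 0 `sorry`.  Imports BY NAME this seat's parts XXVI ∕ XXIV (`exists_coordMat_ne_zero`; through it XV), dag-n15-c `…N15ContourSums` (`lineSum`, `norm_lineSum_le`, `norm_lineSum_two_spacing_le`),
(V5) `…N15BackgroundAveragingWords` (`fibAvg`, §5 `hasMaj_fibAvg_comp`, `hasMaj_idef_fibAvg_comp`), 13a `…N15ExpLetters` (`norm_adCLM_le_of_le`, `norm_adCLM_sub_le`); n15-b 14∕16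
`mmulOp`∕`hasMaj_mmulOp`∕`coordMat`∕`rowBound_of_opNormBound`∕`hasMaj_idef_mmulOp_of_opNormFit` through them; nothing in the tree is modified.

WHY.  dag-n15-c's `…N15VectorPieceVWordsLinear` typed the linearised averaging species of [Balaban1985BackgroundPropagators] (3.57)–(3.58) for the VECTOR piece: kernel
`ad(η·Σ_Γ A′)` in coordinates.  Part XVII took the ABELIAN site twin (`φ ∘ A′`).  THIS FILE is the COLOURED site twin: on the coloured fine-site carrier `Tor(fine n) × ι` the kernel is
the MATRIX `coordMat e (ad(η·lineSum A′ (x, ν)))` — colours mixed —, `F₂ = Q∘mmulOp k`, `F₂* = mmulOp k∘Q*` with `Q = fibAvg (liftMap blockOf ι)` (the plain block mean, colour by colour).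
LETTERS (at FILE 40's sized window `‖A′‖ ≤ c₃₅Mα₀`, one-step differences `≤ c₃₅Mα₀η′`): rows `≤ κ_e·2(d+1)c₃₅Mα₀` (`norm_lineSum_le`, `‖ad Z‖ ≤ 2‖Z‖`, `rowBound_of_opNormBound`);
fit `≤ κ_e·2(d+1)(2d+3)c₃₅Mα₀·L^{−k}` (`norm_lineSum_two_spacing_le` with the King-fibre oscillation of `A′`, `‖ad Z₁ − ad Z₂‖ ≤ 2‖Z₁ − Z₂‖`, `hasMaj_idef_mmulOp_of_opNormFit`); both
through `Q` by (V5) §5 under the uniform fibres of `liftMap pr ι`.  `K_cav = 2(d+1)(2d+3)κ_e c₃₅`.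

CONTENTS.  §1 `card_fibre_liftMap_underPtN`; `colAvgKer` (the matrix contour kernel at spacing `1∕n`), `colAvgFc∕Fsc∕Ff∕Fsf` (the species); §2 ★★ `colAvgSpecies_letters` (six letters AT SIZE, every index, every
`γ ≤ 2`); §3 POSITIVE CONTROL — `colAvgKer_const_bpt_one` (`k(n·y + (1,…,1)) = ((d+1)∕n)·[ad a]_e` at `A′ ≡ a`), `fibAvg_mmulOp_single`, ★ `colAvgFf_const_ne_zero`
(at a NON-CENTRAL constant gauge field, `ad a ≠ 0`, the fine coloured averaging species is a non-zero operator whenever `L^mL^k ≥ 2` — the coloured words carry content exactly where the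
algebra is non-abelian, and vanish identically for commutative `𝔄`).

HONEST FRAMING.  Count-neutral helper; elementary lattice bookkeeping over DISPLAYED letters; MODEL-LEVEL exactly as dag-n15-c's vector-piece species (FIRST-ORDER kernel of (3.57) at the
`U ≡ 1` geometry, one-level staircase contour, plain block mean, King's pairing, starred kernel = unstarred) — NOT the print's `F′₂ⱼ(A)` with parallel transports ∕ multi-level contours ∕
`R(·)`.  NE2⁺ NOT PRINTED ∕ NOT proved; **N15 is NOT discharged** (typed 28∕28 · discharged 5∕27 of record unchanged); K3⁷ OPEN, its N15 pin untouched; one finite four-torus programme at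
fixed `ε` — NOT ℝ⁴, NOT infinite volume, NOT OS, NOT a mass gap, NOT Clay; R4 closes the conditional finite-𝕋⁴ rung `BalabanLadder.UV` only.  Restate-immune.
-/

set_option autoImplicit false

noncomputable section

open scoped BigOperators Matrix
open Finset

namespace Summit.QuantumFields.YangMills.BalabanUVNodes.N15.SiteLayerBg

open Literature.MathematicalPhysics.QuantumFieldTheory.Balaban1983to89
open Literature.MathematicalPhysics.QuantumFieldTheory.Balaban1983to89.B11SectG (BlockNorm HasMaj)
open Literature.MathematicalPhysics.QuantumFieldTheory.Balaban1983to89.T4EtaRateDefect (idef)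
open Literature.MathematicalPhysics.QuantumFieldTheory.Balaban1983to89.T4EtaRateCoeffDefect (pull diagK diagK_mono fibre mem_fibre)
open Literature.MathematicalPhysics.QuantumFieldTheory.Balaban1983to89.B5Prop11Plancherel (Tor fine)
open Literature.MathematicalPhysics.QuantumFieldTheory.Balaban1983to89.B5Block118 (bpt)
open Literature.MathematicalPhysics.QuantumFieldTheory.Balaban1983to89.Beta.AveragingCorrectionJets (adCLM adCLM_smul)
open Literature.MathematicalPhysics.QuantumFieldTheory.King1986.Torus (blockOf)
open Summit.QuantumFields.YangMills.BalabanUVNodes.N15.VectorPiece (unitTorusGeoS kingPr kingPrV kingPrV_eq bshiftEquiv lineSum lineSum_bpt stairSum norm_lineSum_le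
  norm_lineSum_two_spacing_le fibre_conn_kingPrV)
open Summit.QuantumFields.YangMills.BalabanUVNodes.N15.MatrixSpecies (liftMap liftBlk mmulOp mmulOp_apply hasMaj_mmulOp coordMat basisConst basisConst_nonneg rowBound_of_opNormBound
  hasMaj_idef_mmulOp_of_opNormFit norm_adCLM_le_of_le norm_adCLM_sub_le blockAvgV fit_blockAvgV norm_blockAvgV_le)
open Summit.QuantumFields.YangMills.BalabanUVNodes.N15.TwoGrid (TGIndex)
open Summit.QuantumFields.YangMills.BalabanUVNodes.N15.BackgroundLayer (inv_pow_le_rate fibAvg fibAvg_apply hasMaj_fibAvg_comp hasMaj_idef_fibAvg_comp gavgM fgInstanceV1GS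
  coordMat_smul)
open Summit.QuantumFields.YangMills.BalabanUVNodes.N15.GenuineRecord (TGIndexS)
open Summit.QuantumFields.YangMills.BalabanUVNodes.N15.DefectKernel (card_fibre_kingProj)
open Summit.QuantumFields.YangMills.BalabanUVNodes.N15KingModelRung.Curved (underPtN val_underPtN)

variable {d : ℕ} {L : ℕ} [NeZero L]

/-! ## §1 The colour-lifted King pairing has uniform fibres; the matrix contour kernels; the four species -/

section Species

variable (ι : Type) [Fintype ι] [DecidableEq ι]

/-- The colour-lifted King pairing `liftMap pr ι` has uniform fibres `(L^m)^{d+1}` (the colour coordinate is carried along). [folklore] -/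
theorem card_fibre_liftMap_underPtN (k m : ℕ) (Mn : Fin (d + 1) → ℕ) [∀ μ, NeZero (Mn μ)] :
    ∃ N : ℕ, N ≠ 0 ∧ ∀ p : Tor (fine (L ^ k) Mn) × ι, (fibre (liftMap (underPtN L k m Mn) ι) p).card = N := by
  classical
  refine ⟨(L ^ m) ^ (d + 1), pow_ne_zero _ (pow_ne_zero _ (NeZero.ne L)), fun p => ?_⟩
  rw [← card_fibre_kingProj L k m Mn (underPtN L k m Mn) (val_underPtN L k m Mn) p.1]
  refine Finset.card_bij (fun q _ => q.1) (fun q hq => ?_) (fun q₁ hq₁ q₂ hq₂ h => ?_) (fun x' hx' => ?_)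
  · exact (mem_fibre (underPtN L k m Mn) p.1 q.1).2 (congrArg Prod.fst ((mem_fibre (liftMap (underPtN L k m Mn) ι) p q).1 hq))
  · have e1 : q₁.2 = p.2 := congrArg Prod.snd ((mem_fibre (liftMap (underPtN L k m Mn) ι) p q₁).1 hq₁)
    have e2 : q₂.2 = p.2 := congrArg Prod.snd ((mem_fibre (liftMap (underPtN L k m Mn) ι) p q₂).1 hq₂)
    exact Prod.ext h (e1.trans e2.symm)
  · exact ⟨(x', p.2), (mem_fibre (liftMap (underPtN L k m Mn) ι) p (x', p.2)).2 (Prod.ext ((mem_fibre (underPtN L k m Mn) p.1 x').1 hx') rfl), rfl⟩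

variable {𝔄 : Type} [NormedRing 𝔄] [NormedAlgebra ℝ 𝔄] (e : 𝔄 ≃L[ℝ] (ι → ℝ)) (n : ℕ) [NeZero n] (Mn : Fin (d + 1) → ℕ) [∀ μ, NeZero (Mn μ)]

/-- THE MATRIX CONTOUR KERNEL at spacing `η = 1∕n` for an `𝔄`-valued bond function `A` and a component `ν`, in coordinates `e`: `k(x) = coordMat e (ad(η·Σ_{b ∈ Γ_{B(x),x}} A(b)))` — the
first order of (3.57)'s contour transport, colours MIXED (dag-n15-c's `linKerC` on sites). [cite: Balaban1985BackgroundPropagators, (3.55)–(3.58) pp.401–402 (the kernel `F′₂(A; y, x)`: first-order shape)] -/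
def colAvgKer (A : Fin (d + 1) → Tor (fine n Mn) × Fin (d + 1) → 𝔄) (ν : Fin (d + 1)) (x : Tor (fine n Mn)) : Matrix ι ι ℝ :=
  coordMat e (adCLM ℝ ((((n : ℕ) : ℝ))⁻¹ • lineSum n Mn A (x, ν)))

variable (L)

/-- THE COARSE COLOURED AVERAGING SPECIES `F₂(A) = Q∘M_{k(A)}` at spacing `L^{−k}` (coloured fine functions ↦ coloured unit-lattice functions). [cite: Balaban1985BackgroundPropagators, (3.58)–(3.59) p.402 (shape)] -/
def colAvgFc (k : ℕ) (A : Fin (d + 1) → Tor (fine (L ^ k) Mn) × Fin (d + 1) → 𝔄) (ν : Fin (d + 1)) : (Tor (fine (L ^ k) Mn) × ι → ℝ) →ₗ[ℝ] (Tor Mn × ι → ℝ) :=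
  fibAvg (liftMap (blockOf (L ^ k) Mn) ι) ∘ₗ mmulOp (colAvgKer ι e (L ^ k) Mn A ν)

/-- THE COARSE STARRED COLOURED AVERAGING SPECIES `F₂*(A) = M_{k(A)}∘Q*`. [cite: Balaban1985BackgroundPropagators, (3.60) p.402 (shape)] -/
def colAvgFsc (k : ℕ) (A : Fin (d + 1) → Tor (fine (L ^ k) Mn) × Fin (d + 1) → 𝔄) (ν : Fin (d + 1)) : (Tor Mn × ι → ℝ) →ₗ[ℝ] (Tor (fine (L ^ k) Mn) × ι → ℝ) :=
  mmulOp (colAvgKer ι e (L ^ k) Mn A ν) ∘ₗ pull (liftMap (blockOf (L ^ k) Mn) ι)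

/-- THE FINE COLOURED AVERAGING SPECIES `F₂′(A′)` at spacing `L^{−k}L^{−m}`. [cite: Balaban1985BackgroundPropagators, (3.58)–(3.59) p.402 (shape); King1986, p.664] -/
def colAvgFf (k m : ℕ) (A' : Fin (d + 1) → Tor (fine (L ^ m * L ^ k) Mn) × Fin (d + 1) → 𝔄) (ν : Fin (d + 1)) :
    (Tor (fine (L ^ m * L ^ k) Mn) × ι → ℝ) →ₗ[ℝ] (Tor Mn × ι → ℝ) :=
  fibAvg (liftMap (blockOf (L ^ k) Mn ∘ underPtN L k m Mn) ι) ∘ₗ mmulOp (colAvgKer ι e (L ^ m * L ^ k) Mn A' ν)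

/-- THE FINE STARRED COLOURED AVERAGING SPECIES `F₂*′(A′)`. [cite: Balaban1985BackgroundPropagators, (3.60) p.402 (shape); King1986, p.664] -/
def colAvgFsf (k m : ℕ) (A' : Fin (d + 1) → Tor (fine (L ^ m * L ^ k) Mn) × Fin (d + 1) → 𝔄) (ν : Fin (d + 1)) :
    (Tor Mn × ι → ℝ) →ₗ[ℝ] (Tor (fine (L ^ m * L ^ k) Mn) × ι → ℝ) :=
  mmulOp (colAvgKer ι e (L ^ m * L ^ k) Mn A' ν) ∘ₗ pull (liftMap (blockOf (L ^ k) Mn ∘ underPtN L k m Mn) ι)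

end Species

/-! ## §2 ★★ The six letters AT SIZE at FILE 40's family, from `Reg335` -/

section Letters

variable (d) (𝔄 : Type) [NormedRing 𝔄] [NormedAlgebra ℝ 𝔄] [CompleteSpace 𝔄] (ι : Type) [Fintype ι] [DecidableEq ι] [Nonempty ι] (e : 𝔄 ≃L[ℝ] (ι → ℝ))

omit [CompleteSpace 𝔄] [Nonempty ι] in
/-- ★★ **THE SIX LETTERS OF THE COLOURED AVERAGING SPECIES, AT SIZE, FROM `Reg335`** at every index `(j, ν)` of FILE 40's family and every `γ ≤ 2`: for `α₀ > 0` and a fine gauge field `A′` in the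
(3.35) window (`‖A′‖ ≤ c₃₅M_jα₀`, one-step differences `≤ c₃₅M_jα₀·η′`) — sup letters `≤ diagK (K_cav (M_jα₀))` for `F₂(Ā′), F₂*(Ā′), F₂′(A′), F₂*′(A′)` (frames `liftBlk blockOf ι → fst` etc.) and fits
`𝔇(F₂′, F₂), 𝔇(F₂*′, F₂*) ≤ diagK (K_cav (M_jα₀)(L^k)^{−γ∕2})`; `K_cav = 2(d+1)(2d+3)κ_e c₃₅`. [cite: Balaban1985BackgroundPropagators, (3.35) p.396 (letters at size, shape), (3.58)–(3.59) p.402 (shape); King1986, p.664 (pairing)] -/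
theorem colAvgSpecies_letters (hL : Odd L ∧ 1 < L) {c35 : ℝ} (hc35 : 0 ≤ c35) {γ : ℝ} (hγ2 : γ ≤ 2) (j : TGIndexS × Fin (d + 1)) {α₀ : ℝ} (hα₀ : 0 < α₀)
    (A : (fgInstanceV1GS d 𝔄 ι hL j).Bf.Cfg) (hA : (fgInstanceV1GS d 𝔄 ι hL j).Bf.Reg335 c35 α₀ A) :
    HasMaj (BlockNorm.ofBlocks (unitTorusGeoS L j.1.k (TGIndex.Mn d hL j.1.toTGIndex) j.1.Msz) (liftBlk (blockOf (L ^ j.1.k) (TGIndex.Mn d hL j.1.toTGIndex)) ι))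
        (BlockNorm.ofBlocks (unitTorusGeoS L j.1.k (TGIndex.Mn d hL j.1.toTGIndex) j.1.Msz) (fun p : Tor (TGIndex.Mn d hL j.1.toTGIndex) × ι => p.1))
        (colAvgFc L ι e (TGIndex.Mn d hL j.1.toTGIndex) j.1.k ((fgInstanceV1GS d 𝔄 ι hL j).pair.avg A) j.2)
        (diagK fun _ => 2 * ((d : ℝ) + 1) * (2 * (d : ℝ) + 3) * basisConst e * c35 * (j.1.Msz * α₀)) ∧
      HasMaj (BlockNorm.ofBlocks (unitTorusGeoS L j.1.k (TGIndex.Mn d hL j.1.toTGIndex) j.1.Msz) (fun p : Tor (TGIndex.Mn d hL j.1.toTGIndex) × ι => p.1))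
        (BlockNorm.ofBlocks (unitTorusGeoS L j.1.k (TGIndex.Mn d hL j.1.toTGIndex) j.1.Msz) (liftBlk (blockOf (L ^ j.1.k) (TGIndex.Mn d hL j.1.toTGIndex)) ι))
        (colAvgFsc L ι e (TGIndex.Mn d hL j.1.toTGIndex) j.1.k ((fgInstanceV1GS d 𝔄 ι hL j).pair.avg A) j.2)
        (diagK fun _ => 2 * ((d : ℝ) + 1) * (2 * (d : ℝ) + 3) * basisConst e * c35 * (j.1.Msz * α₀)) ∧
      HasMaj (BlockNorm.ofBlocks (unitTorusGeoS L j.1.k (TGIndex.Mn d hL j.1.toTGIndex) j.1.Msz)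
          (liftBlk (blockOf (L ^ j.1.k) (TGIndex.Mn d hL j.1.toTGIndex) ∘ underPtN L j.1.k j.1.m (TGIndex.Mn d hL j.1.toTGIndex)) ι))
        (BlockNorm.ofBlocks (unitTorusGeoS L j.1.k (TGIndex.Mn d hL j.1.toTGIndex) j.1.Msz) (fun p : Tor (TGIndex.Mn d hL j.1.toTGIndex) × ι => p.1))
        (colAvgFf L ι e (TGIndex.Mn d hL j.1.toTGIndex) j.1.k j.1.m A j.2) (diagK fun _ => 2 * ((d : ℝ) + 1) * (2 * (d : ℝ) + 3) * basisConst e * c35 * (j.1.Msz * α₀)) ∧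
      HasMaj (BlockNorm.ofBlocks (unitTorusGeoS L j.1.k (TGIndex.Mn d hL j.1.toTGIndex) j.1.Msz) (fun p : Tor (TGIndex.Mn d hL j.1.toTGIndex) × ι => p.1))
        (BlockNorm.ofBlocks (unitTorusGeoS L j.1.k (TGIndex.Mn d hL j.1.toTGIndex) j.1.Msz)
          (liftBlk (blockOf (L ^ j.1.k) (TGIndex.Mn d hL j.1.toTGIndex) ∘ underPtN L j.1.k j.1.m (TGIndex.Mn d hL j.1.toTGIndex)) ι))
        (colAvgFsf L ι e (TGIndex.Mn d hL j.1.toTGIndex) j.1.k j.1.m A j.2) (diagK fun _ => 2 * ((d : ℝ) + 1) * (2 * (d : ℝ) + 3) * basisConst e * c35 * (j.1.Msz * α₀)) ∧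
      HasMaj (BlockNorm.ofBlocks (unitTorusGeoS L j.1.k (TGIndex.Mn d hL j.1.toTGIndex) j.1.Msz) (liftBlk (blockOf (L ^ j.1.k) (TGIndex.Mn d hL j.1.toTGIndex)) ι))
        (BlockNorm.ofBlocks (unitTorusGeoS L j.1.k (TGIndex.Mn d hL j.1.toTGIndex) j.1.Msz) (fun p : Tor (TGIndex.Mn d hL j.1.toTGIndex) × ι => p.1))
        (idef (pull (liftMap (underPtN L j.1.k j.1.m (TGIndex.Mn d hL j.1.toTGIndex)) ι)) LinearMap.id (colAvgFf L ι e (TGIndex.Mn d hL j.1.toTGIndex) j.1.k j.1.m A j.2)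
          (colAvgFc L ι e (TGIndex.Mn d hL j.1.toTGIndex) j.1.k ((fgInstanceV1GS d 𝔄 ι hL j).pair.avg A) j.2))
        (diagK fun _ => 2 * ((d : ℝ) + 1) * (2 * (d : ℝ) + 3) * basisConst e * c35 * (j.1.Msz * α₀) * ((L : ℝ) ^ j.1.k) ^ (-(γ / 2))) ∧
      HasMaj (BlockNorm.ofBlocks (unitTorusGeoS L j.1.k (TGIndex.Mn d hL j.1.toTGIndex) j.1.Msz) (fun p : Tor (TGIndex.Mn d hL j.1.toTGIndex) × ι => p.1))
        (BlockNorm.ofBlocks (unitTorusGeoS L j.1.k (TGIndex.Mn d hL j.1.toTGIndex) j.1.Msz)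
          (liftBlk (blockOf (L ^ j.1.k) (TGIndex.Mn d hL j.1.toTGIndex) ∘ underPtN L j.1.k j.1.m (TGIndex.Mn d hL j.1.toTGIndex)) ι))
        (idef LinearMap.id (pull (liftMap (underPtN L j.1.k j.1.m (TGIndex.Mn d hL j.1.toTGIndex)) ι)) (colAvgFsf L ι e (TGIndex.Mn d hL j.1.toTGIndex) j.1.k j.1.m A j.2)
          (colAvgFsc L ι e (TGIndex.Mn d hL j.1.toTGIndex) j.1.k ((fgInstanceV1GS d 𝔄 ι hL j).pair.avg A) j.2))
        (diagK fun _ => 2 * ((d : ℝ) + 1) * (2 * (d : ℝ) + 3) * basisConst e * c35 * (j.1.Msz * α₀) * ((L : ℝ) ^ j.1.k) ^ (-(γ / 2))) := by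
  obtain ⟨hA1, hA2, -⟩ := reg335_fgInstanceV1GS_explicit d 𝔄 ι hL j c35 α₀ A hA
  set M := TGIndex.Mn d hL j.1.toTGIndex with hMdef
  set k := j.1.k with hkdef
  set m := j.1.m with hmdef
  set ν := j.2 with hνdef
  have hL0 : 0 < L := Nat.pos_of_ne_zero (NeZero.ne L)
  have hL1 : (1 : ℝ) ≤ (L : ℝ) := by exact_mod_cast hL0
  have hMsz : 0 ≤ j.1.Msz := le_trans zero_le_one j.1.one_le_Msz
  have hκ : 0 ≤ basisConst e := basisConst_nonneg e
  have hd0 : (0 : ℝ) ≤ d := Nat.cast_nonneg d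
  have hθ : 0 ≤ ((L : ℝ) ^ k) ^ (-(γ / 2)) := Real.rpow_nonneg (pow_nonneg (Nat.cast_nonneg _) _) _
  set s : ℝ := j.1.Msz * α₀ with hsdef
  have hs : 0 ≤ s := mul_nonneg hMsz hα₀.le
  set r : ℝ := c35 * s with hrdef
  have hr : 0 ≤ r := mul_nonneg hc35 hs
  have hAn : ∀ μ b, ‖A μ b‖ ≤ r := fun μ b => (hA1 μ b).trans_eq (by rw [hrdef, hsdef]; ring)
  have havg : (fgInstanceV1GS d 𝔄 ι hL j).pair.avg A = gavgM 𝔄 (Fin (d + 1)) (kingPrV L k m M) A := rfl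
  rw [havg]
  set Abar := gavgM 𝔄 (Fin (d + 1)) (kingPrV L k m M) A with hAbar
  have hAbar_le : ∀ μ b, ‖Abar μ b‖ ≤ r := fun μ b => norm_blockAvgV_le (kingPrV L k m M) hr (hAn μ) b
  -- the scaled contour sums and the kernels' operator norms
  have hLk : (0 : ℝ) < ((L ^ k : ℕ) : ℝ) := by positivity
  have hLmk : (0 : ℝ) < ((L ^ m * L ^ k : ℕ) : ℝ) := by positivity
  have hkerC : ∀ x : Tor (fine (L ^ k) M), ‖adCLM ℝ ((((L ^ k : ℕ) : ℝ))⁻¹ • lineSum (L ^ k) M Abar (x, ν))‖ ≤ 2 * (((d : ℝ) + 1) * r) := fun x => by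
    refine norm_adCLM_le_of_le ?_
    rw [norm_smul, Real.norm_eq_abs, abs_of_pos (inv_pos.2 hLk)]
    calc (((L ^ k : ℕ) : ℝ))⁻¹ * ‖lineSum (L ^ k) M Abar (x, ν)‖ ≤ (((L ^ k : ℕ) : ℝ))⁻¹ * (((d : ℝ) + 1) * (L ^ k : ℕ) * r) :=
          mul_le_mul_of_nonneg_left (norm_lineSum_le (L ^ k) M hr hAbar_le (x, ν)) (inv_nonneg.2 hLk.le)
      _ = ((d : ℝ) + 1) * r := by field_simp
  have hkerF : ∀ x' : Tor (fine (L ^ m * L ^ k) M), ‖adCLM ℝ ((((L ^ m * L ^ k : ℕ) : ℝ))⁻¹ • lineSum (L ^ m * L ^ k) M A (x', ν))‖ ≤ 2 * (((d : ℝ) + 1) * r) := fun x' => by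
    refine norm_adCLM_le_of_le ?_
    rw [norm_smul, Real.norm_eq_abs, abs_of_pos (inv_pos.2 hLmk)]
    calc (((L ^ m * L ^ k : ℕ) : ℝ))⁻¹ * ‖lineSum (L ^ m * L ^ k) M A (x', ν)‖ ≤ (((L ^ m * L ^ k : ℕ) : ℝ))⁻¹ * (((d : ℝ) + 1) * (L ^ m * L ^ k : ℕ) * r) :=
          mul_le_mul_of_nonneg_left (norm_lineSum_le (L ^ m * L ^ k) M hr hAn (x', ν)) (inv_nonneg.2 hLmk.le)
      _ = ((d : ℝ) + 1) * r := by field_simp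
  -- the multipliers' size letters (rows `≤ κ_e·2(d+1)r`)
  set R : ℝ := basisConst e * (2 * (((d : ℝ) + 1) * r)) with hRdef
  have hR : 0 ≤ R := by positivity
  have hMc := hasMaj_mmulOp (g := unitTorusGeoS L k M j.1.Msz) (ι := ι) (blockOf (L ^ k) M) (C := colAvgKer ι e (L ^ k) M Abar ν) (m := fun _ => R) (fun _ => hR)
    (fun x i => rowBound_of_opNormBound e (C := fun x => adCLM ℝ ((((L ^ k : ℕ) : ℝ))⁻¹ • lineSum (L ^ k) M Abar (x, ν))) hkerC x i)
  have hMf := hasMaj_mmulOp (g := unitTorusGeoS L k M j.1.Msz) (ι := ι) (blockOf (L ^ k) M ∘ underPtN L k m M) (C := colAvgKer ι e (L ^ m * L ^ k) M A ν) (m := fun _ => R)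
    (fun _ => hR) (fun x' i => rowBound_of_opNormBound e (C := fun x' => adCLM ℝ ((((L ^ m * L ^ k : ℕ) : ℝ))⁻¹ • lineSum (L ^ m * L ^ k) M A (x', ν))) hkerF x' i)
  -- the multipliers' two-grid defect (pointwise King-fibre fit of `A′`, contour projection)
  have hstep : ∀ μ κ b, ‖A μ (bshiftEquiv M (L ^ m * L ^ k) κ b) - A μ b‖ ≤ r * ((((L : ℝ) ^ k))⁻¹ * (((L : ℝ) ^ m))⁻¹) := fun μ κ b =>
    (hA2 μ κ b).trans_eq (by rw [hrdef, hsdef]; ring)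
  set Ω : ℝ := ((2 * ((d + 1) * (L ^ m - 1)) : ℕ) : ℝ) * (r * ((((L : ℝ) ^ k))⁻¹ * (((L : ℝ) ^ m))⁻¹)) with hΩdef
  have hΩ0 : 0 ≤ Ω := by positivity
  have hfitA : ∀ μ b', ‖A μ b' - Abar μ (kingPrV L k m M b')‖ ≤ Ω := fun μ b' =>
    fit_blockAvgV (kingPrV L k m M) (Ω := fun _ => Ω) (fun x₁' x₂' h => fibre_conn_kingPrV L k m M (A μ) _ (fun κ i => hstep μ κ i) x₁' x₂' h) b'
  have hΩle : Ω ≤ 2 * ((d : ℝ) + 1) * r * (((L ^ k : ℕ) : ℝ))⁻¹ := by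
    have hLm' : (0 : ℝ) < (L : ℝ) ^ m := by positivity
    have hLk' : (0 : ℝ) < (L : ℝ) ^ k := by positivity
    have h1 : ((2 * ((d + 1) * (L ^ m - 1)) : ℕ) : ℝ) ≤ 2 * ((d : ℝ) + 1) * (L : ℝ) ^ m := by
      have : ((L ^ m - 1 : ℕ) : ℝ) ≤ ((L ^ m : ℕ) : ℝ) := by exact_mod_cast Nat.sub_le _ _
      push_cast [Nat.cast_sub (Nat.one_le_pow _ _ hL0)] at this ⊢
      nlinarith
    calc Ω ≤ 2 * ((d : ℝ) + 1) * (L : ℝ) ^ m * (r * ((((L : ℝ) ^ k))⁻¹ * (((L : ℝ) ^ m))⁻¹)) := mul_le_mul_of_nonneg_right h1 (by positivity)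
      _ = 2 * ((d : ℝ) + 1) * r * (((L ^ k : ℕ) : ℝ))⁻¹ := by push_cast; field_simp
  have hkerD : ∀ x' : Tor (fine (L ^ m * L ^ k) M),
      ‖adCLM ℝ ((((L ^ m * L ^ k : ℕ) : ℝ))⁻¹ • lineSum (L ^ m * L ^ k) M A (x', ν)) - adCLM ℝ ((((L ^ k : ℕ) : ℝ))⁻¹ • lineSum (L ^ k) M Abar (underPtN L k m M x', ν))‖
        ≤ 2 * (((d : ℝ) + 1) * (Ω + (((L ^ k : ℕ) : ℝ))⁻¹ * r)) := fun x' => by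
    refine (norm_adCLM_sub_le _ _).trans (mul_le_mul_of_nonneg_left ?_ zero_le_two)
    have hη : (((L ^ k : ℕ) : ℝ))⁻¹ = ((L ^ m : ℕ) : ℝ) * (((L ^ m * L ^ k : ℕ) : ℝ))⁻¹ := by push_cast; field_simp
    have hls := norm_lineSum_two_spacing_le L k m M (E := 𝔄) hr hΩ0 (inv_nonneg.2 hLmk.le) hη hAn hfitA (x', ν)
    rw [kingPrV_eq] at hls
    have e1 : ((L ^ k : ℕ) : ℝ) * ((L ^ m : ℕ) : ℝ) * (((L ^ m * L ^ k : ℕ) : ℝ))⁻¹ = 1 := by push_cast; field_simp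
    rw [e1, one_mul, ← hη] at hls
    exact hls
  set o : ℝ := basisConst e * (2 * (((d : ℝ) + 1) * (Ω + (((L ^ k : ℕ) : ℝ))⁻¹ * r))) with hodef
  have ho : 0 ≤ o := by positivity
  have hMD := hasMaj_idef_mmulOp_of_opNormFit (g := unitTorusGeoS L k M j.1.Msz) (ι := ι) e (blockOf (L ^ k) M) (underPtN L k m M)
    (C' := fun x' => adCLM ℝ ((((L ^ m * L ^ k : ℕ) : ℝ))⁻¹ • lineSum (L ^ m * L ^ k) M A (x', ν)))
    (C := fun x => adCLM ℝ ((((L ^ k : ℕ) : ℝ))⁻¹ • lineSum (L ^ k) M Abar (x, ν))) (o := fun _ => 2 * (((d : ℝ) + 1) * (Ω + (((L ^ k : ℕ) : ℝ))⁻¹ * r)))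
    (fun _ => by positivity) (fun x' => hkerD x')
  -- through the block mean (uniform fibres of the colour-lifted pairing)
  have hq : ∀ p : Tor (fine (L ^ k) M) × ι, liftBlk (blockOf (L ^ k) M) ι p = (liftMap (blockOf (L ^ k) M) ι p).1 := fun _ => rfl
  obtain ⟨N, hN, hfib⟩ := card_fibre_liftMap_underPtN (L := L) ι k m M
  obtain ⟨h1, h2⟩ := hasMaj_fibAvg_comp (g := unitTorusGeoS L k M j.1.Msz) (liftBlk (blockOf (L ^ k) M) ι) (fun p : Tor M × ι => p.1) (liftMap (blockOf (L ^ k) M) ι) hq hR hMc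
  obtain ⟨h3, h4⟩ := hasMaj_fibAvg_comp (g := unitTorusGeoS L k M j.1.Msz) (liftBlk (blockOf (L ^ k) M ∘ underPtN L k m M) ι) (fun p : Tor M × ι => p.1)
    (liftMap (blockOf (L ^ k) M ∘ underPtN L k m M) ι) (fun _ => rfl) hR hMf
  obtain ⟨h5, h6⟩ := hasMaj_idef_fibAvg_comp (g := unitTorusGeoS L k M j.1.Msz) (liftBlk (blockOf (L ^ k) M) ι) (fun p : Tor M × ι => p.1) (liftMap (blockOf (L ^ k) M) ι)
    (liftMap (underPtN L k m M) ι) hq hN hfib ho hMD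
  -- constants
  have hrate : (((L ^ k : ℕ) : ℝ))⁻¹ ≤ ((L : ℝ) ^ k) ^ (-(γ / 2)) := inv_pow_le_rate (L := L) hL1 (by linarith)
  have hsize : R ≤ 2 * ((d : ℝ) + 1) * (2 * (d : ℝ) + 3) * basisConst e * c35 * s := by
    rw [hRdef, hrdef]; nlinarith [mul_nonneg (mul_nonneg hκ (mul_nonneg hc35 hs)) hd0, mul_nonneg hκ (mul_nonneg hc35 hs)]
  have hfitc : o ≤ 2 * ((d : ℝ) + 1) * (2 * (d : ℝ) + 3) * basisConst e * c35 * s * ((L : ℝ) ^ k) ^ (-(γ / 2)) := by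
    have h1' : Ω + (((L ^ k : ℕ) : ℝ))⁻¹ * r ≤ (2 * ((d : ℝ) + 1) + 1) * r * (((L ^ k : ℕ) : ℝ))⁻¹ := by nlinarith [hΩle]
    have h2' : (2 * ((d : ℝ) + 1) + 1) * r * (((L ^ k : ℕ) : ℝ))⁻¹ ≤ (2 * ((d : ℝ) + 1) + 1) * r * ((L : ℝ) ^ k) ^ (-(γ / 2)) :=
      mul_le_mul_of_nonneg_left hrate (by positivity)
    have h3' := h1'.trans h2'
    calc o = basisConst e * (2 * (((d : ℝ) + 1) * (Ω + (((L ^ k : ℕ) : ℝ))⁻¹ * r))) := hodef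
      _ ≤ basisConst e * (2 * (((d : ℝ) + 1) * ((2 * ((d : ℝ) + 1) + 1) * r * ((L : ℝ) ^ k) ^ (-(γ / 2))))) :=
          mul_le_mul_of_nonneg_left (mul_le_mul_of_nonneg_left (mul_le_mul_of_nonneg_left h3' (by positivity)) zero_le_two) hκ
      _ = 2 * ((d : ℝ) + 1) * (2 * (d : ℝ) + 3) * basisConst e * c35 * s * ((L : ℝ) ^ k) ^ (-(γ / 2)) := by rw [hrdef]; ring
  exact ⟨h1.mono fun y y' => diagK_mono (fun _ => hsize) y y', h2.mono fun y y' => diagK_mono (fun _ => hsize) y y',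
    h3.mono fun y y' => diagK_mono (fun _ => hsize) y y', h4.mono fun y y' => diagK_mono (fun _ => hsize) y y',
    h5.mono fun y y' => diagK_mono (fun _ => hfitc) y y', h6.mono fun y y' => diagK_mono (fun _ => hfitc) y y'⟩

end Letters

/-! ## §3 Positive control: the coloured averaging species is not identically zero -/

section PositiveControl

variable {ι : Type} [Fintype ι] [DecidableEq ι] {𝔄 : Type} [NormedRing 𝔄] [NormedAlgebra ℝ 𝔄] (e : 𝔄 ≃L[ℝ] (ι → ℝ))

/-- THE MATRIX KERNEL AT A CONSTANT GAUGE FIELD, ONE STEP OFF THE BLOCK CORNER IN EVERY DIRECTION: for `A′ ≡ a` and the fine point `x = n·y + (1, …, 1)` (`n ≥ 2`) the staircase contour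
has exactly `d + 1` bonds, so `k(x) = ((d+1)∕n)·[ad a]_e`. [folklore] -/
theorem colAvgKer_const_bpt_one (n : ℕ) [NeZero n] (hn : 2 ≤ n) (Mn : Fin (d + 1) → ℕ) [∀ μ, NeZero (Mn μ)] (a : 𝔄) (ν : Fin (d + 1)) (y : Tor Mn) :
    colAvgKer ι e n Mn (fun _ _ => a) ν (bpt n Mn y fun _ => ⟨1, by omega⟩) = ((((n : ℕ) : ℝ))⁻¹ * ((d : ℝ) + 1)) • coordMat e (adCLM ℝ a) := by
  unfold colAvgKer
  rw [lineSum_bpt]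
  have hstair : stairSum n Mn (fun _ _ => a) y (fun _ => ⟨1, by omega⟩) ν = ((d : ℝ) + 1) • a := by
    unfold stairSum
    have hinner : ∀ μ : Fin (d + 1), (∑ t : Fin n, if (t : ℕ) < ((fun _ : Fin (d + 1) => (⟨1, by omega⟩ : Fin n)) μ : ℕ) then a else 0) = a := fun μ => by
      have h0 : ∀ t : Fin n, ((t : ℕ) < ((⟨1, by omega⟩ : Fin n) : ℕ)) ↔ t = ⟨0, by omega⟩ := fun t => by
        rw [Fin.ext_iff]; simp only; constructor <;> intro h <;> omega
      simp_rw [h0]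
      rw [Finset.sum_ite_eq' Finset.univ (⟨0, by omega⟩ : Fin n) (fun _ => a), if_pos (Finset.mem_univ _)]
    rw [Finset.sum_congr rfl fun μ _ => hinner μ, Finset.sum_const, Finset.card_univ, Fintype.card_fin, ← Nat.cast_smul_eq_nsmul ℝ]
    push_cast; rfl
  rw [hstair, smul_smul, adCLM_smul, coordMat_smul]

/-- A colour-lifted block mean of a matrix multiplier applied to the indicator of one coloured fine point `(x, j)` returns, at `(q x, i)`, the kernel entry `k(x)_{ij}` over the fibre
size. [folklore] -/
theorem fibAvg_mmulOp_single {X Y : Type} [Fintype X] [DecidableEq X] [DecidableEq Y] (q : X → Y) (K : X → Matrix ι ι ℝ) (x : X) (i j : ι) :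
    (fibAvg (liftMap q ι) ∘ₗ mmulOp K) (Pi.single (x, j) 1) (q x, i) = K x i j / (fibre (liftMap q ι) (q x, i)).card := by
  classical
  rw [LinearMap.comp_apply, fibAvg_apply]
  congr 1
  have hfun : ∀ p : X × ι, mmulOp K (Pi.single (x, j) (1 : ℝ)) p = if p.1 = x then K x p.2 j else 0 := fun p => by
    rw [mmulOp_apply]
    by_cases hp : p.1 = x
    · rw [if_pos hp]
      rw [Finset.sum_eq_single j (fun j' _ hj' => by rw [Pi.single_eq_of_ne (fun h => hj' (congrArg Prod.snd h)), mul_zero]) (fun h => (h (Finset.mem_univ _)).elim)]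
      rw [hp, Pi.single_eq_same, mul_one]
    · rw [if_neg hp]
      exact Finset.sum_eq_zero fun j' _ => by rw [Pi.single_eq_of_ne (fun h => hp (congrArg Prod.fst h)), mul_zero]
  rw [Finset.sum_congr rfl fun p _ => hfun p]
  rw [Finset.sum_ite, Finset.sum_const_zero, add_zero]
  have hfilter : (fibre (liftMap q ι) (q x, i)).filter (fun p : X × ι => p.1 = x) = {(x, i)} := by
    ext p
    simp only [Finset.mem_filter, Finset.mem_singleton, mem_fibre, liftMap, Prod.ext_iff]
    constructor
    · rintro ⟨⟨_, h2⟩, h1⟩; exact ⟨h1, h2⟩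
    · rintro ⟨h1, h2⟩; exact ⟨⟨by rw [h1], h2⟩, h1⟩
  rw [hfilter, Finset.sum_singleton]

variable (L) (ι)

/-- ★ **POSITIVE CONTROL — THE COLOURED AVERAGING SPECIES IS NOT IDENTICALLY ZERO**: at the CONSTANT gauge field `A′ ≡ a` with `a` NOT CENTRAL (`ad a ≠ 0`; such `a` lie in every (3.35)
window wide enough for `‖a‖`, one-step differences vanish), on any spacing pair with `L^mL^k ≥ 2`, the fine coloured averaging species `F₂′(A′)` is a NON-ZERO operator: some entry
`[ad a]_{ij} ≠ 0`, and tested on the indicator of the coloured fine point `(n·0 + (1,…,1), j)` it returns `((d+1)∕n)·[ad a]_{ij}∕#fibre ≠ 0` at `(0, i)`.  So the coloured averaging words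
carry content at non-trivial NON-ABELIAN backgrounds — and vanish identically when `𝔄` is commutative (`ad ≡ 0`), as they must: the abelianised parts XVII–XIX used `φ∘A′` instead. [folklore] -/
theorem colAvgFf_const_ne_zero (Mn : Fin (d + 1) → ℕ) [∀ μ, NeZero (Mn μ)] (k m : ℕ) (hn : 2 ≤ L ^ m * L ^ k) {a : 𝔄} (ha : adCLM ℝ a ≠ 0) (ν : Fin (d + 1)) :
    colAvgFf L ι e Mn k m (fun _ _ => a) ν ≠ 0 := by
  classical
  set n' := L ^ m * L ^ k with hn'
  haveI : NeZero n' := ⟨by positivity⟩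
  -- a non-zero matrix entry of `ad a` in coordinates (part XXIV §6)
  obtain ⟨i, j, hij⟩ := exists_coordMat_ne_zero e ha
  intro h0
  set x' : Tor (fine n' Mn) := bpt n' Mn 0 fun _ => ⟨1, by omega⟩ with hx'
  set q : Tor (fine n' Mn) → Tor Mn := blockOf (L ^ k) Mn ∘ underPtN L k m Mn with hq
  have heval : (colAvgFf L ι e Mn k m (fun _ _ => a) ν) (Pi.single (x', j) 1) (q x', i)
      = colAvgKer ι e n' Mn (fun _ _ => a) ν x' i j / (fibre (liftMap q ι) (q x', i)).card :=
    fibAvg_mmulOp_single q (colAvgKer ι e n' Mn (fun _ _ => a) ν) x' i j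
  rw [h0, LinearMap.zero_apply, Pi.zero_apply] at heval
  have hker : colAvgKer ι e n' Mn (fun _ _ => a) ν x' i j = (((n' : ℕ) : ℝ))⁻¹ * ((d : ℝ) + 1) * coordMat e (adCLM ℝ a) i j := by
    rw [hx', colAvgKer_const_bpt_one e n' hn Mn a ν 0, Matrix.smul_apply, smul_eq_mul]
  have hcard : (0 : ℝ) < (fibre (liftMap q ι) (q x', i)).card := by
    exact_mod_cast Finset.card_pos.2 ⟨(x', i), (mem_fibre (liftMap q ι) (q x', i) (x', i)).2 rfl⟩
  have hn0 : (0 : ℝ) < ((n' : ℕ) : ℝ) := by exact_mod_cast Nat.pos_of_ne_zero (NeZero.ne n')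
  have hne : colAvgKer ι e n' Mn (fun _ _ => a) ν x' i j ≠ 0 := by
    rw [hker]; exact mul_ne_zero (mul_ne_zero (inv_ne_zero hn0.ne') (by positivity)) hij
  exact hne (by
    have := heval.symm
    rwa [div_eq_zero_iff, or_iff_left hcard.ne'] at this)

end PositiveControl

end Summit.QuantumFields.YangMills.BalabanUVNodes.N15.SiteLayerBg

end
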